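import Summits.ResolutionOfSingularities.ResolutionOfSingularities.Theses.WildQuotients

/-!
# `WildQuotientResolution` — negative lemmas III: the action may be assumed faithful

Support (negative) lemma for crux `stmt-ResolutionOfSingularities-15640`
(`Summit.ResolutionOfSingularities.ResolutionOfSingularities.Theses.WildQuotients.WildQuotientResolution`),
filed by the standing disprover (cdisprove gen 1; work file
`Cruxes/WildQuotientResolution/Disproof.lean`). No definition; the variant is written inline; the
only declaration is an `↔` with the route decl (no positive proof of it).

* `wqFaithful_iff` — **the group datum is only used through its image**: restricting the crux to
  FAITHFUL actions (`Function.Injective ρ`) gives an equivalent statement, because `G ⧸ ker ρ` acts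
  on `X'` through `QuotientGroup.kerLift ρ` with the same invariance and the same orbits, and is
  again a finite group. (So inertia and stabiliser groups may be computed in `im ρ ⊆ Aut X'`, as
  the crux ideas do; together with `Negative.wq_allNat_iff` and the cusp model this completes the
  bookkeeping of which binders of the crux carry content.)

## Sources
* N. Bourbaki, *Algèbre* I §4 (passage to the quotient by the kernel of an action); SGA 1 Exp. V §1
  (quotients by finite groups: only the image in `Aut` matters). [folklore]
-/

noncomputable section

-- single-problem summit: the doubled namespace component `ResolutionOfSingularities` is forced
set_option linter.dupNamespace false

open CategoryTheory AlgebraicGeometry TopologicalSpace Topology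
open Literature.AlgebraicGeometry.Resolution

namespace Summit.ResolutionOfSingularities.ResolutionOfSingularities.Theorems.WildQuotientResolution.Negative

open Summit.ResolutionOfSingularities.ResolutionOfSingularities.Theses.WildQuotients
  (WildQuotientResolution)

/-- **Faithful actions suffice**: the crux restricted to injective `ρ : G →* Aut X'` is equivalent
to the crux. (`→`: replace `G` by `G ⧸ ker ρ` acting through `QuotientGroup.kerLift ρ`, which is
injective, finite, leaves `q` invariant and has the same orbits; `←`: forget injectivity.)
[folklore] -/
theorem wqFaithful_iff :
    (∀ p : ℕ, p.Prime → ∀ (k : Type) [Field k] [CharP k p] (X' X₁ : Scheme.{0})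
        (f : X₁ ⟶ Spec (.of k)) (q : X' ⟶ X₁) (G : Type) [Group G] [Finite G] (ρ : G →* Aut X'),
        Function.Injective ρ →
        IsSeparated f → LocallyOfFiniteType f → QuasiCompact f → IsIntegral X₁ → IsIntegral X' →
        Scheme.IsRegular X' → IsFinite q → Function.Surjective q.base →
        (∃ U : X₁.Opens, Dense (U : Set X₁) ∧ Etale (q ∣_ U)) → (∀ g : G, (ρ g).hom ≫ q = q) →
        (∀ x y : X', q.base x = q.base y → ∃ g : G, (ρ g).hom.base x = y) →
        Scheme.HasResolution X₁) ↔
      WildQuotientResolution := by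
  constructor
  · intro h p hp k _ _ X' X₁ f q G _ _ ρ hs hl hq hi1 hi' hreg hfin hsurj hU hinv horb
    refine h p hp k X' X₁ f q (G ⧸ ρ.ker) (QuotientGroup.kerLift ρ)
      (QuotientGroup.kerLift_injective ρ) hs hl hq hi1 hi' hreg hfin hsurj hU ?_ ?_
    · intro g
      induction g using QuotientGroup.induction_on with
      | H g => rw [QuotientGroup.kerLift_mk]; exact hinv g
    · intro x y hxy
      obtain ⟨g, hg⟩ := horb x y hxy
      exact ⟨(g : G ⧸ ρ.ker), by rw [QuotientGroup.kerLift_mk]; exact hg⟩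
  · intro h p hp k _ _ X' X₁ f q G _ _ ρ _ hs hl hq hi1 hi' hreg hfin hsurj hU hinv horb
    exact h p hp k X' X₁ f q G ρ hs hl hq hi1 hi' hreg hfin hsurj hU hinv horb

end Summit.ResolutionOfSingularities.ResolutionOfSingularities.Theorems.WildQuotientResolution.Negative

end
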